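import Literature.Topology.FourManifolds.LeftHandSphereLocal
import Literature.Topology.FourManifolds.RelatedFlows
import HarnessLib

/-!
# The chart map between two Milnor boxes: coordinates, levels, smoothness, and the flows

Topic `Literature/Topology/FourManifolds` (support file for the two-field handle-extension
endgame of `stmt-SmoothPoincare4-15190`).  Everything here is **proved**; no named facts.
This is the analogue, for Milnor's *raw* boxes `Literature.Topology.FourManifolds.MilnorBox`
(`f = f q + Q_k(u)`, `dφ̂ X = F_k(u)`, `GradientLikeDynamics.lean`), of `HandleChartMap.lean`
(which treats the normalised handle charts `HandleChart`, `dφ̂ X = Ê_{k,r}(u)`); the proofs are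
the same.

Two Milnor boxes `D` (about `p` in `M`, for `f, X`) and `D'` (about `p'` in `M'`, for
`f', X'`) of the same index carry the same model in coordinates.  The **chart map**
`D.chartMap D' = φ̂'⁻¹ ∘ (φ̂' p' + ·) ∘ (φ̂ - φ̂ p)` ("identify the two coordinate systems",
Milnor 1965, proof of Thm. 3.13) therefore:

* preserves the centred coordinates (`coord_chartMap`), shifts the levels by `f' p' - f p`
  (`apply_chartMap`), and is inverted by the chart map the other way (`chartMap_chartMap`);
* is smooth on the open chart ball `MilnorBox.chartBall` of radius `3ε'` (`contMDiffOn_chartMap`);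
* **intertwines the fields**, `d(chartMap)(X) = X' ∘ chartMap` on that ball
  (`mfderiv_chartMap_apply`), hence **conjugates the flows** as long as an orbit stays in the
  ball (`IsFlowOf.milnorBox_chartMap_apply_eq`, by `RelatedFlows.lean`).

Combined with twisted boxes (`MilnorBox.twist`) this gives the model conjugations
`ψ' ∘ S ∘ ψ⁻¹` between the boxes of two gradient-like fields at two saddles.

## References

* J. Milnor, *Lectures on the h-cobordism theorem* (1965), Def. 3.1 and proofs of Thms. 3.12,
  3.13 (PDF pp. 12, 17–19). [MilnorHCobordism1965]
* J. M. Lee, *Introduction to Smooth Manifolds*, 2nd ed. (2012), Prop. 9.13. [LeeSmoothManifolds2013]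
-/

open scoped Manifold ContDiff Topology
open Set Function Filter Metric

noncomputable section

namespace Literature.Topology.FourManifolds

universe u

variable {m : ℕ} {H : Type*} [TopologicalSpace H] {J : ModelWithCorners ℝ (EuclideanSpace ℝ (Fin m)) H}
  {M : Type u} [TopologicalSpace M] [ChartedSpace H M]
  {M' : Type u} [TopologicalSpace M'] [ChartedSpace H M']

namespace MilnorBox

variable {f : M → ℝ} {X : Π x : M, TangentSpace J x} {p : M}
  {f' : M' → ℝ} {X' : Π x : M', TangentSpace J x} {p' : M'}
  (D : MilnorBox J f X p) (D' : MilnorBox J f' X' p')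

/-! ### The chart ball -/

/-- **The open chart ball** `{q ∈ φ.source | ‖u‖ < R}` of a Milnor box. [folklore] -/
def chartBall (R : ℝ) : Set M := {q | q ∈ D.chart.source ∧ ‖D.coord q‖ < R}

variable {R : ℝ}

/-- Membership in the chart ball. [folklore] -/
theorem mem_chartBall_iff {x : M} : x ∈ D.chartBall R ↔ x ∈ D.chart.source ∧ ‖D.coord x‖ < R := Iff.rfl

/-- The chart ball is open. [folklore] -/
theorem isOpen_chartBall : IsOpen (D.chartBall R) := by
  have h := D.continuousOn_coord.isOpen_inter_preimage D.chart.open_source (isOpen_ball (x := (0 : (EuclideanSpace ℝ (Fin m)))) (ε := R))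
  convert h using 1
  ext q
  simp [chartBall]

/-- The centre lies in every chart ball of positive radius. [folklore] -/
theorem mem_chartBall_self (hR : 0 < R) : p ∈ D.chartBall R :=
  ⟨D.mem_source, by rw [D.coord_self, norm_zero]; exact hR⟩

/-- The chart points `ψ w`, `‖w‖ < R ≤ 3ε`, lie in the chart ball. [folklore] -/
theorem symm_add_mem_chartBall (hR : R ≤ 3 * D.ε) {w : (EuclideanSpace ℝ (Fin m))} (hw : ‖w‖ < R) :
    (D.chart.extend J).symm (D.chart.extend J p + w) ∈ D.chartBall R := by
  have hw' : ‖w‖ ≤ 3 * D.ε := hw.le.trans hR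
  exact ⟨D.symm_add_mem_source hw', by rw [D.coord_symm_add hw']; exact hw⟩

/-- A point of the chart ball is `ψ` of its coordinates. [folklore] -/
theorem symm_add_coord_of_mem_chartBall {x : M} (hx : x ∈ D.chartBall R) :
    (D.chart.extend J).symm (D.chart.extend J p + D.coord x) = x :=
  D.symm_add_coord hx.1

/-! ### The chart map -/

/-- **The chart map** `φ̂'⁻¹ ∘ (φ̂' p' + ·) ∘ (φ̂ - φ̂ p)` from the box `D` to the box `D'`
(the identification of the two Milnor coordinate systems). [cite: MilnorHCobordism1965, Def. 3.1 and proof of Thm. 3.13] -/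
def chartMap (x : M) : M' := (D'.chart.extend J).symm (D'.chart.extend J p' + D.coord x)

/-- The chart map lands in the source of `D'`, with the same coordinates (`‖u‖ ≤ 3ε'`). [folklore] -/
theorem chartMap_mem_source_and_coord {x : M} (hx : ‖D.coord x‖ ≤ 3 * D'.ε) :
    D.chartMap D' x ∈ D'.chart.source ∧ D'.coord (D.chartMap D' x) = D.coord x :=
  ⟨D'.symm_add_mem_source hx, D'.coord_symm_add hx⟩

/-- **The chart map preserves the coordinates.** [folklore] -/
theorem coord_chartMap {x : M} (hx : ‖D.coord x‖ ≤ 3 * D'.ε) : D'.coord (D.chartMap D' x) = D.coord x :=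
  (D.chartMap_mem_source_and_coord D' hx).2

/-- The chart map sends the chart ball into the chart ball (`R ≤ 3ε'`). [folklore] -/
theorem chartMap_mem_chartBall (hR : R ≤ 3 * D'.ε) {x : M} (hx : x ∈ D.chartBall R) :
    D.chartMap D' x ∈ D'.chartBall R := by
  obtain ⟨hs, hc⟩ := D.chartMap_mem_source_and_coord D' (hx.2.le.trans hR)
  exact ⟨hs, by rw [hc]; exact hx.2⟩

/-- The chart map sends the centre to the centre. [folklore] -/
theorem chartMap_self : D.chartMap D' p = p' := by
  rw [chartMap, D.coord_self]; exact D'.symm_add_zero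

/-- **The chart map shifts the levels by `f' p' - f p`** (same normal form, same index).
[cite: MilnorHCobordism1965, Def. 3.1] -/
theorem apply_chartMap (hk : D.k = D'.k) {x : M} (hxs : x ∈ D.chart.source) (hx : ‖D.coord x‖ ≤ 3 * D'.ε) :
    f' (D.chartMap D' x) = f x + (f' p' - f p) := by
  obtain ⟨hs, hc⟩ := D.chartMap_mem_source_and_coord D' hx
  have h1 := D'.apply_eq _ hs
  have h2 := D.apply_eq x hxs
  change f' (D.chartMap D' x) = f' p' + milnorQuadratic D'.k (D'.coord (D.chartMap D' x)) at h1
  change f x = f p + milnorQuadratic D.k (D.coord x) at h2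
  rw [h1, hc, ← hk, h2]; ring

/-- With equal critical values the chart map preserves the levels. [cite: MilnorHCobordism1965, Def. 3.1] -/
theorem apply_chartMap_of_eq (hk : D.k = D'.k) (hpp : f' p' = f p) {x : M} (hxs : x ∈ D.chart.source)
    (hx : ‖D.coord x‖ ≤ 3 * D'.ε) : f' (D.chartMap D' x) = f x := by
  rw [D.apply_chartMap D' hk hxs hx, hpp, sub_self, add_zero]

/-- **The two chart maps are inverse to each other** on the chart balls. [folklore] -/
theorem chartMap_chartMap {x : M} (hxs : x ∈ D.chart.source) (hx : ‖D.coord x‖ ≤ 3 * D'.ε) :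
    D'.chartMap D (D.chartMap D' x) = x := by
  rw [chartMap, D.coord_chartMap D' hx, coord, add_sub_cancel,
    (D.chart.extend J).left_inv (by rw [D.chart.extend_source]; exact hxs)]

/-- `|x⃗|²` of the image. [folklore] -/
theorem sqSumLT_coord_chartMap (hk : D.k = D'.k) {x : M} (hx : ‖D.coord x‖ ≤ 3 * D'.ε) :
    sqSumLT D'.k (D'.coord (D.chartMap D' x)) = sqSumLT D.k (D.coord x) := by
  rw [D.coord_chartMap D' hx, hk]

/-- `|y⃗|²` of the image. [folklore] -/
theorem sqSumGE_coord_chartMap (hk : D.k = D'.k) {x : M} (hx : ‖D.coord x‖ ≤ 3 * D'.ε) :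
    sqSumGE D'.k (D'.coord (D.chartMap D' x)) = sqSumGE D.k (D.coord x) := by
  rw [D.coord_chartMap D' hx, hk]

/-! ### Smoothness -/

/-- An open ball inside the target of an extended chart lies in the interior of the range of the
model, so the inverse extended chart is smooth there (not only within the range).
[folklore] -/
theorem contMDiffAt_extend_symm [IsManifold J ∞ M'] {y : (EuclideanSpace ℝ (Fin m))} (hy : y ∈ ball (D'.chart.extend J p') (3 * D'.ε)) :
    ContMDiffAt 𝓘(ℝ, (EuclideanSpace ℝ (Fin m))) J ∞ (D'.chart.extend J).symm y := by
  have hsub : ball (D'.chart.extend J p') (3 * D'.ε) ⊆ (D'.chart.extend J).target :=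
    ball_subset_closedBall.trans D'.closedBall_subset
  have h := contMDiffOn_extend_symm (I := J) D'.mem_maximalAtlas
  rw [← D'.chart.extend_target' (I := J)] at h
  exact (h y (hsub hy)).contMDiffAt (mem_of_superset (isOpen_ball.mem_nhds hy) hsub)

/-- **The chart map is smooth at every point of the chart domain with `‖u‖ < 3ε'`.** [folklore] -/
theorem contMDiffAt_chartMap [IsManifold J ∞ M'] {x : M} (hxs : x ∈ D.chart.source) (hx : ‖D.coord x‖ < 3 * D'.ε) :
    ContMDiffAt J J ∞ (D.chartMap D') x := by
  have h1 : ContMDiffAt J 𝓘(ℝ, (EuclideanSpace ℝ (Fin m))) ∞ (fun q => D'.chart.extend J p' + D.coord q) x :=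
    contMDiffAt_const.add (((D.chart.contMDiffAt_extend D.mem_maximalAtlas hxs).sub contMDiffAt_const))
  have hy : D'.chart.extend J p' + D.coord x ∈ ball (D'.chart.extend J p') (3 * D'.ε) := by
    rw [mem_ball, dist_eq_norm, add_sub_cancel_left]; exact hx
  exact (D'.contMDiffAt_extend_symm hy).comp x h1

/-- **The chart map is smooth on the open chart ball** of radius `R ≤ 3ε'`. [folklore] -/
theorem contMDiffOn_chartMap [IsManifold J ∞ M'] (hR : R ≤ 3 * D'.ε) :
    ContMDiffOn J J ∞ (D.chartMap D') (D.chartBall R) := fun _ hx =>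
  (D.contMDiffAt_chartMap D' hx.1 (hx.2.trans_le hR)).contMDiffWithinAt

/-! ### The chart map intertwines the fields -/

/-- **The chart map intertwines the fields**: `d(chartMap)(X x) = X' (chartMap x)` on the open
chart ball of radius `3ε'` (both fields are `F_k` in coordinates; same index).
[cite: MilnorHCobordism1965, Def. 3.1 and proof of Thm. 3.13] -/
theorem mfderiv_chartMap_apply [IsManifold J ∞ M] [IsManifold J ∞ M'] (hk : D.k = D'.k)
    {x : M} (hx : x ∈ D.chartBall (3 * D'.ε)) :
    mfderiv J J (D.chartMap D') x (X x) = X' (D.chartMap D' x) := by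
  set Φ := D.chart.extend J with hΦ
  set Φ' := D'.chart.extend J with hΦ'
  set c : (EuclideanSpace ℝ (Fin m)) := Φ p with hc
  set c' : (EuclideanSpace ℝ (Fin m)) := Φ' p' with hc'
  set u : (EuclideanSpace ℝ (Fin m)) := D.coord x with hu
  set y : M' := D.chartMap D' x with hy
  obtain ⟨hys, hyc⟩ := D.chartMap_mem_source_and_coord D' hx.2.le
  have hcu : c' + u ∈ ball c' (3 * D'.ε) := by rw [mem_ball, dist_eq_norm, add_sub_cancel_left]; exact hx.2
  have hcu_t : c' + u ∈ Φ'.target := (ball_subset_closedBall.trans D'.closedBall_subset) hcu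
  -- derivative of the affine map `T q = c' + coord q`
  have hΦx : HasMFDerivAt J 𝓘(ℝ, (EuclideanSpace ℝ (Fin m))) Φ x (mfderiv J 𝓘(ℝ, (EuclideanSpace ℝ (Fin m))) Φ x) :=
    (mdifferentiableAt_extend_of_mem_maximalAtlas D.mem_maximalAtlas hx.1).hasMFDerivAt
  have hg : HasMFDerivAt 𝓘(ℝ, (EuclideanSpace ℝ (Fin m))) 𝓘(ℝ, (EuclideanSpace ℝ (Fin m))) (fun v : (EuclideanSpace ℝ (Fin m)) => c' + (v - c)) (Φ x)
      (ContinuousLinearMap.id ℝ (EuclideanSpace ℝ (Fin m))) := by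
    rw [hasMFDerivAt_iff_hasFDerivAt]
    exact ((hasFDerivAt_id _).sub_const c).const_add c'
  have hT : HasMFDerivAt J 𝓘(ℝ, (EuclideanSpace ℝ (Fin m))) (fun q => c' + D.coord q) x (mfderiv J 𝓘(ℝ, (EuclideanSpace ℝ (Fin m))) Φ x) :=
    (hg.comp x hΦx).congr_mfderiv (ContinuousLinearMap.id_comp _)
  -- derivative of `Φ'.symm` at `c' + u`
  set L := mfderiv 𝓘(ℝ, (EuclideanSpace ℝ (Fin m))) J Φ'.symm (c' + u) with hL
  have hΦ's : HasMFDerivAt 𝓘(ℝ, (EuclideanSpace ℝ (Fin m))) J Φ'.symm (c' + u) L :=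
    ((D'.contMDiffAt_extend_symm hcu).mdifferentiableAt (by simp)).hasMFDerivAt
  have hchain : HasMFDerivAt J J (D.chartMap D') x (L.comp (mfderiv J 𝓘(ℝ, (EuclideanSpace ℝ (Fin m))) Φ x)) :=
    hΦ's.comp x hT
  rw [hchain.mfderiv]
  change L (mfderiv J 𝓘(ℝ, (EuclideanSpace ℝ (Fin m))) (D.chart.extend J) x (X x)) = X' y
  rw [D.mfderiv_eq x hx.1]
  -- the field `X'` at `y` in coordinates
  have hX'y : mfderiv J 𝓘(ℝ, (EuclideanSpace ℝ (Fin m))) Φ' y (X' y) = milnorModelField D.k u := by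
    have h1 := D'.mfderiv_eq y hys
    change mfderiv J 𝓘(ℝ, (EuclideanSpace ℝ (Fin m))) Φ' y (X' y) = milnorModelField D'.k (D'.coord y) at h1
    rw [h1, hyc, hk]
  -- `L ∘ dΦ'_y = id`
  have hLid : L.comp (mfderiv J 𝓘(ℝ, (EuclideanSpace ℝ (Fin m))) Φ' y) = ContinuousLinearMap.id ℝ _ := by
    have h1 := mfderivWithin_extend_symm_comp_mfderiv_extend (I := J) D'.mem_maximalAtlas hcu_t
    have hy' : Φ'.symm (c' + u) = y := rfl
    rw [hy'] at h1
    have hnhds : range J ∈ 𝓝 (c' + u) :=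
      mem_of_superset (isOpen_ball.mem_nhds hcu)
        ((ball_subset_closedBall.trans D'.closedBall_subset).trans (D'.chart.extend_target_subset_range (I := J)))
    rw [mfderivWithin_of_mem_nhds hnhds] at h1
    exact h1
  have := congrArg (fun T : TangentSpace J y →L[ℝ] TangentSpace J y => T (X' y)) hLid
  change L (mfderiv J 𝓘(ℝ, (EuclideanSpace ℝ (Fin m))) Φ' y (X' y)) = X' y at this
  rw [hX'y] at this
  exact this

end MilnorBox

/-! ### The chart map conjugates the flows -/

section Flows

variable {f : M → ℝ} {X : Π x : M, TangentSpace J x} {θ : ℝ × M → M} {p : M}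
  {f' : M' → ℝ} {X' : Π x : M', TangentSpace J x} {θ' : ℝ × M' → M'} {p' : M'}
  [IsManifold J ∞ M] [IsManifold J ∞ M'] [T2Space M']

/-- **The chart map of two Milnor boxes conjugates the flows** as long as the orbit stays in the
chart ball of radius `3ε'`: `chartMap (θ (t, z)) = θ' (t, chartMap z)` (naturality of flows for
the chart-related fields, `IsFlowOf.apply_eq_of_mfderiv_eq_of_Icc`). [cite: LeeSmoothManifolds2013, Prop. 9.13] -/
theorem IsFlowOf.milnorBox_chartMap_apply_eq (h : IsFlowOf J X θ) (h' : IsFlowOf J X' θ')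
    (hX' : ContMDiff J J.tangent 1 fun y => (⟨y, X' y⟩ : TangentBundle J M'))
    (D : MilnorBox J f X p) (D' : MilnorBox J f' X' p')
    (hk : D.k = D'.k) {z : M} {T₁ T₂ : ℝ} (hT₁ : T₁ ≤ 0) (hT₂ : 0 ≤ T₂)
    (hmem : ∀ t ∈ Icc T₁ T₂, θ (t, z) ∈ D.chartBall (3 * D'.ε)) {t : ℝ} (ht : t ∈ Icc T₁ T₂) :
    D.chartMap D' (θ (t, z)) = θ' (t, D.chartMap D' z) :=
  h.apply_eq_of_mfderiv_eq_of_Icc h' hX' D.isOpen_chartBall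
    ((D.contMDiffOn_chartMap D' le_rfl).of_le (by exact_mod_cast le_top))
    (fun x hx => D.mfderiv_chartMap_apply D' hk hx) hT₁ hT₂ hmem ht

end Flows

end Literature.Topology.FourManifolds
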